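import Summits.BirchSwinnertonDyer.Rank1Residual.ManinAdditive.Gamma1LatticeBalancedCuspDifferences
import HarnessLib
import HarnessLib.Audit.Tags

/-!
# E-es-68: the DEGENERACY-LOOP LAW (f-shadow of the Ribet–Ihara equaliser law (K_t)) — typed, with its easy half
# PROVED (es g18, MEMO-es §31.17 (B)/(D); cell `bsd-f2-manin`, typing ask T-es-23, typer g13)

HONEST FRAMING.  LENS = Euler systems / explicit reciprocity (`bsd-f2-manin-es` g18).  SOURCE = HOME/es/Sketch-es-g18-bal.lean
00ba62a68f72b567 §4f/§4g (= Sketch-es-g18.lean ef55fface19232db §4f/§4g), VERBATIM up to the namespace and the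
`@[conjecture]` tags on the two rows E-es-68₈ / E-es-68₉ (the general schema `DegeneracyLoopLaw t` stays a plain `def`:
REF1 §R67 — for `t ∈ {0, 1}` it reads «Λ₁(f) = ⊥», junk-FALSE and unreachable; es asserts it for `t ≥ 2` and uses
`t = 8, 9` only).  THE LAW: for `N ≥ 2` and every `f ∈ S₂(Γ₀(N))` the degeneracy loops `{∞, t·b/m}_f − {∞, b/m}_f`
(`m` prime, `m ∤ tN`, `m ∤ b`) GENERATE `Λ₁(f) = periodLatticeGamma1 f`; homologically the equaliser
`ker(B₁^* − B_t^* : J₀(N) → J₀(tN)) ∩ J₀(N)_tors` is exactly the Shimura subgroup `Σ(N)` — Ribet 1984 Thm 4.3 for `t`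
prime `∤ N` (THEOREM); for `t = p ∣ N` «not known in general» (Yoo 2018); E-es-68₈ (`t = 8`, `4 ∣ N`) = GEN⋆₂ and
E-es-68₉ (`t = 9`, `9 ∣ N`) = GEN⋆₃ of MEMO-es §31.11 = the law input LAW-V of the es line (E-es-66 ⟸ GEN⋆).  PROVED
here (es, kernel-checked): the specialisations `degeneracyLoopLaw{Eight,Nine}_of_law`, `modularSymbol_sub_mem_periodLatticeGamma1`
(same conductor ⟹ difference ∈ `Λ₁(f)`, via LEMMA A of the sibling THEOREM-B file) and the EASY HALF
`closure_degeneracyLoops_le` (every loop lies in `Λ₁(f)`).  BC5 WITNESS: E42 v2 GEN⋆ 177/177 `(p, N)` + E42e K-test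
400/400 cells `[S : U_t] = |G/I|` (t ∈ {2,3,4,5,8,9}; HOME/es/E42e-KT-LOOPSPAN-v1.txt 29ba11b4943d5841), SECOND ENGINE
REF1 E2k (PARI, e67/kt.gp 3361b07e362630ad): 55/55 levels, 1 100/1 100 K-cells identical + 69 further levels 1 518/1 518.
CHEAPEST FALSIFIER: one level with `[K_t : Σ(N)] > 1` (D-es-21) — none.  REF1 §R67: **E-es-68/68₈/68₉ SURVIVE (LAW;
BC7 summit-mode CLEAN vs C2/C3)**; REF2 R-es-37 (b): placement deferred to acq-14058 (Ling 1995); nearest print Yoo,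
TAMS 2018 [corpus:paper:arxiv-1510.03016 p. 4] «not known in general».  bears_on: stmt-BirchSwinnertonDyer-22967 (C2,
`t = 8`) and stmt-BirchSwinnertonDyer-22968 (C3 stub 5 via E-es-66, `t = 9`).  PARTITION 0 · beyond-print theorem: no
· BSD is not proved by this; Manin's conjecture is not proved by this.
[cite: Ribet1984, Thm. 4.3 (the equaliser for t prime to N; shape — the t ∣ N law is the cell's row E-es-68, NOT in print)]

§4h (APPENDED 2026-08-28, typer g14, T-es-29 (g)): E-es-91 (K₉)♮ `DegeneracyClassLoopLawNine` — the prime-class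
(`m ≡ 2 (mod 3)`) form of E-es-68₉ (es g22 MEMO-es §36.11/§36.13), with `degeneracyLoopsClassTwo` and three proved edges.
-/

set_option autoImplicit false

noncomputable section

open scoped MatrixGroups ModularForm

open CongruenceSubgroup Literature.NumberTheory.EllipticCurves
  Literature.NumberTheory.EllipticCurves.ModularForms

namespace Summit.BirchSwinnertonDyer.Rank1Residual.ManinAdditive.Gamma1Lattice

variable {N : ℕ} [NeZero N] (f : CuspForm (Gamma0 N) 2)

/-! ## §4f (g18) — E-es-68: the DEGENERACY-LOOP LAW (f-shadow of conjecture (K_t))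

Homologically: the loops `{b/m, t·b/m}` (`m` prime, `m ∤ tN`, `b ∈ (ℤ/m)ˣ`) generate
`L′ = π_* H₁(X₁(N), ℤ) ⊆ H₁(X₀(N), ℤ)`; equivalently (intersection duality + Manin generation at level
`tN`) the equaliser `{x ∈ J₀(N)_tors : B₁^* x = B_t^* x in J₀(tN)}` is exactly the Shimura subgroup
`Σ(N)`. For `t` prime to `N` this is Ribet 1984 (Thm. 4.3, ⟸ Ihara); for `t = p ∣ N` the kernel is
"not known in general" (Yoo 2018, TAMS, arXiv:1510.03016 p. 4; some cases Ling 1995). GEN⋆_p(N) of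
§31.11 is the case `t = 8` (`4 ∣ N`) / `t = 9` (`9 ∣ N`). Applying the period map of any
`f ∈ S₂(Γ₀(N))`: `{∞, t b/m}_f − {∞, b/m}_f` generate `Λ₁(f)`. Census: E42 v2 (177 pairs) and the
K-test (17 levels × t ∈ {2,3,4,5,8,9}, index = |G/I| in every case). -/

/-- The set of **degeneracy loops of ratio `t`**: `{∞, t·b/m}_f − {∞, b/m}_f`, `m` prime, `m ∤ tN`,
`m ∤ b`. -/
def degeneracyLoops (t : ℕ) : Set ℂ :=
  {z | ∃ (m b : ℕ), m.Prime ∧ ¬ m ∣ t * N ∧ ¬ m ∣ b ∧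
      z = modularSymbol f (((t * b : ℕ) : ℚ) / m) - modularSymbol f ((b : ℚ) / m)}

/-- **E-es-68 (DEGENERACY-LOOP LAW, ratio `t`).** For every level `N ≥ 2` and every
`f ∈ S₂(Γ₀(N))`, the degeneracy loops of ratio `t` generate the `Γ₁(N)`-period lattice `Λ₁(f)`.
Ribet 1984 Thm 4.3 gives it for `t` prime, `t ∤ N`; conjectured here for all `t ≥ 2`
(the cases that matter: `t = 8`, `4 ∣ N` and `t = 9`, `9 ∣ N`).  Plain `def` SCHEMA in `t` (REF1 §R67: at `t ∈ {0,1}`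
it reads «Λ₁(f) = ⊥», junk-false and unreachable; the tagged rows are `t = 8, 9` below). -/
def DegeneracyLoopLaw (t : ℕ) : Prop :=
  ∀ {N : ℕ} [NeZero N], 2 ≤ N → ∀ f : CuspForm (Gamma0 N) 2,
    AddSubgroup.closure (degeneracyLoops f t) = periodLatticeGamma1 f

/-- **E-es-68₈**: the ratio-`8` law at levels `4 ∣ N` (= GEN⋆₂ of MEMO-es §31.11, f-shadow).
Cell bsd-f2-manin row E-es-68₈ (es g18; REF1 §R67 SURVIVES, BC7 CLEAN vs C2; two-engine census); nothing asserted.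
[conjecture — cell candidate, NOT a tree fact] -/
@[conjecture]
def DegeneracyLoopLawEight : Prop :=
  ∀ {N : ℕ} [NeZero N], 2 ^ 2 ∣ N → ∀ f : CuspForm (Gamma0 N) 2,
    AddSubgroup.closure (degeneracyLoops f 8) = periodLatticeGamma1 f

/-- **E-es-68₉**: the ratio-`9` law at levels `9 ∣ N` (= GEN⋆₃ of MEMO-es §31.11, f-shadow).
Cell bsd-f2-manin row E-es-68₉ (es g18; REF1 §R67 SURVIVES, BC7 CLEAN vs C3; two-engine census); nothing asserted.
[conjecture — cell candidate, NOT a tree fact] -/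
@[conjecture]
def DegeneracyLoopLawNine : Prop :=
  ∀ {N : ℕ} [NeZero N], 3 ^ 2 ∣ N → ∀ f : CuspForm (Gamma0 N) 2,
    AddSubgroup.closure (degeneracyLoops f 9) = periodLatticeGamma1 f

/-- The general law specialises. -/
theorem degeneracyLoopLawNine_of_law (h : DegeneracyLoopLaw 9) : DegeneracyLoopLawNine := by
  intro N _ h9 f
  have hN : 2 ≤ N := by
    have : 9 ∣ N := by simpa using h9
    have hN0 : N ≠ 0 := NeZero.ne N
    omega
  exact h hN f

/-- The general law specialises (`t = 8`). -/
theorem degeneracyLoopLawEight_of_law (h : DegeneracyLoopLaw 8) : DegeneracyLoopLawEight := by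
  intro N _ h4 f
  have hN : 2 ≤ N := by
    have : 4 ∣ N := by simpa using h4
    have hN0 : N ≠ 0 := NeZero.ne N
    omega
  exact h hN f

/-! ## §4g (g18) — the easy half of E-es-68: degeneracy loops lie in `Λ₁(f)` (PROVED) -/

/-- Same conductor ⟹ the difference of cusp classes lies in `Λ₁(f)`:
`{∞, b/m}_f − {∞, b'/m}_f = {∞, δδ'⁻¹∞}_f` with `δδ'⁻¹ ∈ Γ₁(N)`. -/
theorem modularSymbol_sub_mem_periodLatticeGamma1 {b b' m : ℤ} (hm : m ≠ 0)
    (hb : IsCoprime b m) (hb' : IsCoprime b' m) (hN : IsCoprime (N : ℤ) m) :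
    modularSymbol f ((b : ℚ) / m) - modularSymbol f ((b' : ℚ) / m) ∈ periodLatticeGamma1 f := by
  obtain ⟨δ, hδm, -, hδ⟩ := exists_gamma0_modularSymbol_div f hm hb hN
  obtain ⟨δ', hδ'm, -, hδ'⟩ := exists_gamma0_modularSymbol_div f hm hb' hN
  have e : modularSymbol f ((b : ℚ) / m) - modularSymbol f ((b' : ℚ) / m)
      = cuspSymbol f (δ * δ'⁻¹) := by
    have h := cuspSymbol_mul_holds f (δ * δ'⁻¹) δ'
    rw [inv_mul_cancel_right] at h
    rw [hδ, hδ', h]; ring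
  rw [e]
  -- determinant and `Γ₀` conditions of `δ`, `δ'`
  have hdet : ∀ γ : Gamma0 N, ((γ : SL(2, ℤ)) 0 0 : ℤ) * ((γ : SL(2, ℤ)) 1 1 : ℤ) -
      ((γ : SL(2, ℤ)) 0 1 : ℤ) * ((γ : SL(2, ℤ)) 1 0 : ℤ) = 1 := by
    intro γ
    have := Matrix.det_fin_two ((γ : SL(2, ℤ)) : Matrix (Fin 2) (Fin 2) ℤ)
    rw [(γ : SL(2, ℤ)).2] at this
    exact this.symm
  have hc : (((δ : SL(2, ℤ)) 1 0 : ℤ) : ZMod N) = 0 := Gamma0_mem.mp δ.2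
  have hc' : (((δ' : SL(2, ℤ)) 1 0 : ℤ) : ZMod N) = 0 := Gamma0_mem.mp δ'.2
  have hdZ : (((δ : SL(2, ℤ)) 0 0 : ℤ) : ZMod N) * (m : ZMod N) = 1 := by
    have := congrArg (fun x : ℤ => (x : ZMod N)) (hdet δ)
    simp only [Int.cast_sub, Int.cast_mul, Int.cast_one, hc, mul_zero, sub_zero, hδm] at this
    exact this
  have hdZ' : (((δ' : SL(2, ℤ)) 0 0 : ℤ) : ZMod N) * (m : ZMod N) = 1 := by
    have := congrArg (fun x : ℤ => (x : ZMod N)) (hdet δ')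
    simp only [Int.cast_sub, Int.cast_mul, Int.cast_one, hc', mul_zero, sub_zero, hδ'm] at this
    exact this
  -- entries of `δ δ'⁻¹`
  have hcoe : ((δ * δ'⁻¹ : Gamma0 N) : SL(2, ℤ)) = (δ : SL(2, ℤ)) * (δ' : SL(2, ℤ))⁻¹ := rfl
  have e00 : (((δ : SL(2, ℤ)) * (δ' : SL(2, ℤ))⁻¹ : SL(2, ℤ)) 0 0 : ℤ)
      = ((δ : SL(2, ℤ)) 0 0 : ℤ) * ((δ' : SL(2, ℤ)) 1 1 : ℤ) - ((δ : SL(2, ℤ)) 0 1 : ℤ) * ((δ' : SL(2, ℤ)) 1 0 : ℤ) := by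
    simp [Matrix.SpecialLinearGroup.coe_inv, Matrix.adjugate_fin_two, Matrix.mul_apply, Fin.sum_univ_two]
    ring
  have e11 : (((δ : SL(2, ℤ)) * (δ' : SL(2, ℤ))⁻¹ : SL(2, ℤ)) 1 1 : ℤ)
      = -(((δ : SL(2, ℤ)) 1 0 : ℤ) * ((δ' : SL(2, ℤ)) 0 1 : ℤ)) + ((δ : SL(2, ℤ)) 1 1 : ℤ) * ((δ' : SL(2, ℤ)) 0 0 : ℤ) := by
    simp [Matrix.SpecialLinearGroup.coe_inv, Matrix.adjugate_fin_two, Matrix.mul_apply, Fin.sum_univ_two]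
  have e10 : (((δ : SL(2, ℤ)) * (δ' : SL(2, ℤ))⁻¹ : SL(2, ℤ)) 1 0 : ℤ)
      = ((δ : SL(2, ℤ)) 1 0 : ℤ) * ((δ' : SL(2, ℤ)) 1 1 : ℤ) - ((δ : SL(2, ℤ)) 1 1 : ℤ) * ((δ' : SL(2, ℤ)) 1 0 : ℤ) := by
    simp [Matrix.SpecialLinearGroup.coe_inv, Matrix.adjugate_fin_two, Matrix.mul_apply, Fin.sum_univ_two]
    ring
  have hG1 : ((δ * δ'⁻¹ : Gamma0 N) : SL(2, ℤ)) ∈ Gamma1 N := by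
    rw [hcoe, Gamma1_mem, e00, e11, e10]
    push_cast
    rw [hc, hc', hδ'm, hδm]
    refine ⟨by rw [mul_zero, sub_zero]; exact hdZ, ?_, by rw [zero_mul, mul_zero, sub_zero]⟩
    rw [zero_mul, neg_zero, zero_add, mul_comm]; exact hdZ'
  have := cuspSymbol_mem_periodLatticeGamma1 f ⟨_, hG1⟩
  exact this

/-- **The easy half of E-es-68 (PROVED):** every degeneracy loop lies in `Λ₁(f)`, so
`closure (degeneracyLoops f t) ≤ Λ₁(f)`; the LAW is the reverse inclusion. -/
theorem closure_degeneracyLoops_le (t : ℕ) :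
    AddSubgroup.closure (degeneracyLoops f t) ≤ periodLatticeGamma1 f := by
  rw [AddSubgroup.closure_le]
  rintro z ⟨m, b, hp, hmt, hmb, rfl⟩
  have hm0 : ((m : ℤ)) ≠ 0 := by exact_mod_cast hp.ne_zero
  have cop : ∀ {x : ℕ}, ¬ m ∣ x → IsCoprime (x : ℤ) (m : ℤ) := fun h =>
    Nat.isCoprime_iff_coprime.mpr ((Nat.Prime.coprime_iff_not_dvd hp).mpr h).symm
  have hN : IsCoprime ((N : ℕ) : ℤ) (m : ℤ) := cop (fun h => hmt (Dvd.dvd.mul_left h t))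
  have htb : IsCoprime ((t * b : ℕ) : ℤ) (m : ℤ) := by
    refine cop (fun h => ?_)
    rcases (Nat.Prime.dvd_mul hp).mp h with ht | hb
    · exact hmt (Dvd.dvd.mul_right ht N)
    · exact hmb hb
  have hb : IsCoprime (b : ℤ) (m : ℤ) := cop hmb
  have key := modularSymbol_sub_mem_periodLatticeGamma1 f hm0 htb hb hN
  rw [SetLike.mem_coe]
  simpa only [Int.cast_natCast] using key

/-! ## §4h (g22) — E-es-91 (K₉)♮: the PRIME-CLASS degeneracy-loop law (typing ask T-es-29 (g), typer g14)

es g22 MEMO-es §36.11/§36.13, HOME/es/Sketch-es-g22-thm87.lean sha16 793791e5e4546a7e §U VERBATIM (`degeneracyLoopsClassTwo`,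
`DegeneracyClassLoopLawNine`); the prime-class plus hypothesis `DegeneracyClassPlusIndexPrimeTo`, the edge
`degeneracyClassPlusIndexPrimeTo_of_lawNine` and THEOREM U♮ live in the sibling `DegeneracyClassUnitTwist.lean` (they need
`PlusIndexLaws`, kept out of this file's light import closure).  Typer additions (PROVED, 3 lines each): the trivial
inclusion `degeneracyLoopsClassTwo_subset_degeneracyLoops`, the easy half `closure_degeneracyLoopsClassTwo_le`, and
E-es-91 ⟹ E-es-68₉ `degeneracyLoopLawNine_of_classLawNine` ((K₉)♮ is formally the STRONGER row).  BC5 (es): E42e column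
K9+r = |G/I| at 17/17 levels `9 ∣ N ≤ 171` (class filter `m ≡ 2 (mod 3)`; D-es-29 extends); BC7 summit-mode CLEAN
(es/g22/g22-bc7e.raw.txt).  REF1 R-es-44 PENDING at filing — a finding is repaired under a NEW name (append-only).
bears_on: stmt-BirchSwinnertonDyer-22968 (C3 binder h66 at squarefull levels := (K₉)♮ + `threeAdicPolarWitness_of_classLawNine_squarefull`,
TURNKEY-es-16).  PARTITION 0 · beyond-print theorem: no · BSD is not proved by this; Manin's conjecture is not proved by this. -/

/-- Degeneracy loops of ratio `t` at PRIME denominators in the class `2 (mod 3)` — the tree's `degeneracyLoops f t`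
(`DegeneracyLoopLaws`) VERBATIM with the one extra clause `m % 3 = 2`. -/
def degeneracyLoopsClassTwo (t : ℕ) : Set ℂ :=
  {z | ∃ (m b : ℕ), m.Prime ∧ m % 3 = 2 ∧ ¬ m ∣ t * N ∧ ¬ m ∣ b ∧
      z = modularSymbol f (((t * b : ℕ) : ℚ) / m) - modularSymbol f ((b : ℚ) / m)}

omit [NeZero N] in
/-- Prime-class loops are degeneracy loops (drop the class clause) (typer, PROVED). -/
theorem degeneracyLoopsClassTwo_subset_degeneracyLoops (t : ℕ) :
    degeneracyLoopsClassTwo f t ⊆ degeneracyLoops f t := by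
  rintro z ⟨m, b, hp, -, hmt, hmb, rfl⟩
  exact ⟨m, b, hp, hmt, hmb, rfl⟩

/-- The easy half of E-es-91 (typer, PROVED): every prime-class loop lies in `Λ₁(f)`. -/
theorem closure_degeneracyLoopsClassTwo_le (t : ℕ) :
    AddSubgroup.closure (degeneracyLoopsClassTwo f t) ≤ periodLatticeGamma1 f :=
  (AddSubgroup.closure_mono (degeneracyLoopsClassTwo_subset_degeneracyLoops f t)).trans
    (closure_degeneracyLoops_le f t)

/-- **E-es-91 (K₉)♮ `DegeneracyClassLoopLawNine`** — the PRIME-CLASS form of the cell's ratio-`9` degeneracy-loop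
law E-es-68₉ (`DegeneracyLoopLawNine`, tree `DegeneracyLoopLaws`): at levels `9 ∣ N` the loops
`{∞, 9b/m} − {∞, b/m}` at primes `m ≡ 2 (mod 3)`, `m ∤ 9N`, already generate `Λ₁(f)`.  Equivalent to E-es-68₉ on
paper (generation lemma G, MEMO-es §36.11: the level-`9N` unimodular move `m ↦ m + 9Nbk` pushed through `B₁, B₉`);
census = the (K₉) equaliser census re-run with the class filter (D-es-29).  LAW, nothing asserted.
TYPER FRAMING (E-es-91): lens es; LAW (obligation node), nothing asserted; BC5 / REF1 status in the §4h header above.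
[conjecture — cell candidate, NOT a tree fact] -/
@[conjecture]
def DegeneracyClassLoopLawNine : Prop :=
  ∀ {N : ℕ} [NeZero N], 3 ^ 2 ∣ N → ∀ f : CuspForm (Gamma0 N) 2,
    AddSubgroup.closure (degeneracyLoopsClassTwo f 9) = periodLatticeGamma1 f

/-- **E-es-91 ⟹ E-es-68₉** (typer, PROVED): `closure (class loops) ≤ closure (all loops) ≤ Λ₁(f)`, so equality of the
ends forces equality in the middle — the prime-class law is formally the stronger row. -/
theorem degeneracyLoopLawNine_of_classLawNine (h : DegeneracyClassLoopLawNine) : DegeneracyLoopLawNine := by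
  intro N _ h9 f
  exact le_antisymm (closure_degeneracyLoops_le f 9)
    ((h h9 f).symm.le.trans (AddSubgroup.closure_mono (degeneracyLoopsClassTwo_subset_degeneracyLoops f 9)))

end Summit.BirchSwinnertonDyer.Rank1Residual.ManinAdditive.Gamma1Lattice

end
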